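import Mathlib

/-!
# Chain calculus for crux `ElementaryWordLength.WordPerSuperQuartic`, line `Sketch`:
# the two-reads rigidity lemma (`chain_read_once`)

A *chain* is a product `Π_t (1 + x_{v_t} • N_t)` of `3 × 3` matrices over `MvPolynomial σ ℂ`, one
factor per *letter* `(v_t, N_t)` (a variable and a constant square-zero matrix) of a list `L`.
We prove: if the chain equals `E_02(P') = Matrix.transvection 0 2 P'` and the variable `x_i` is
read by at most one letter of `L`, then `x_i` occurs in `P'` only linearly and with a constant
coefficient: `coeff m P' = 0` whenever `m i ≠ 0` and `m ≠ e_i`.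

## Proof

* If no letter reads `x_i`, every entry of the chain is free of `x_i` (`ro_free_prod`), and `P'`
  is the `(0,2)` entry of the chain.
* If exactly one letter `e₀ = (i, N)` reads `x_i`, split `L = L₁ ++ e₀ :: L₂`; with `A`, `B` the
  chains of `L₁`, `L₂` (free of `x_i`) the hypothesis reads
  `A * B + x_i • (A * N * B) = 1 + P' • E_02`.  Comparing the coefficients of the monomials
  `x^{m'} · x_i` (`ro_key`) shows that `M := A * N * B` is concentrated in its `(0,2)` entry `q`,
  with `coeff m' q = coeff (m' + e_i) P'`.  The factors `1 + x_v • N_t` are units (inverse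
  `1 - x_v • N_t`, as `N_t ^ 2 = 0`), so `N = A⁻¹ * (q • E_02) * B⁻¹ = q • R`; as `N ≠ 0` is
  constant, `q` divides a unit, hence is a unit, hence a constant
  (`MvPolynomial.isUnit_iff_eq_C_of_isReduced`), and `coeff m' q = 0` for `m' ≠ 0`.
-/

-- `Summit.ValiantsHypothesis.ValiantsHypothesis.…` is the tree's mandated single-conjunct layout.
set_option linter.dupNamespace false

namespace Summit.ValiantsHypothesis.ValiantsHypothesis.Theorems.WordPerSuperQuartic

open MvPolynomial

/-- **No reads.**  If no letter of `L` reads the variable `x_i`, every entry of the chain of `L`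
is free of `x_i`: all its monomials `m` with `m i ≠ 0` have coefficient `0`. -/
private theorem ro_free_prod {σ : Type} [DecidableEq σ]
    (F : σ × Matrix (Fin 3) (Fin 3) ℂ → Matrix (Fin 3) (Fin 3) (MvPolynomial σ ℂ))
    (hF : ∀ e, F e = 1 + (X e.1 : MvPolynomial σ ℂ) • e.2.map (C : ℂ → MvPolynomial σ ℂ))
    (i : σ) (L : List (σ × Matrix (Fin 3) (Fin 3) ℂ)) (hL : ∀ e ∈ L, e.1 ≠ i)
    (m : σ →₀ ℕ) (hm : m i ≠ 0) (k l : Fin 3) : coeff m ((L.map F).prod k l) = 0 := by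
  induction L generalizing m k l with
  | nil =>
    have h0 : (0 : σ →₀ ℕ) ≠ m := fun h => hm (by rw [← h, Finsupp.zero_apply])
    rw [List.map_nil, List.prod_nil, Matrix.one_apply]
    split_ifs
    · rw [coeff_one, if_neg h0]
    · rw [coeff_zero]
  | cons e L ih =>
    have hL' : ∀ e' ∈ L, e'.1 ≠ i := fun e' he' => hL e' (List.mem_cons_of_mem e he')
    rw [List.map_cons, List.prod_cons, hF, Matrix.add_mul, Matrix.one_mul, Matrix.smul_mul,
      Matrix.add_apply, coeff_add, ih hL' m hm k l, zero_add, Matrix.smul_apply, smul_eq_mul,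
      coeff_X_mul']
    split_ifs with hmem
    · have hm' : (m - Finsupp.single e.1 1 : σ →₀ ℕ) i ≠ 0 := by
        rwa [Finsupp.tsub_apply, Finsupp.single_apply, if_neg (hL e List.mem_cons_self),
          tsub_zero]
      rw [Matrix.mul_apply, coeff_sum]
      refine Finset.sum_eq_zero fun a _ => ?_
      rw [Matrix.map_apply, coeff_C_mul, ih hL' _ hm' a l, mul_zero]
    · rfl

/-- A square-zero letter `(v, N)` gives a unit factor: `(1 + x_v • N) * (1 - x_v • N) = 1`. -/
private theorem ro_isUnit_factor {σ : Type} (e : σ × Matrix (Fin 3) (Fin 3) ℂ)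
    (he : e.2 * e.2 = 0) :
    IsUnit ((1 : Matrix (Fin 3) (Fin 3) (MvPolynomial σ ℂ)) +
      (X e.1 : MvPolynomial σ ℂ) • e.2.map (C : ℂ → MvPolynomial σ ℂ)) := by
  have hNN : e.2.map (C : ℂ → MvPolynomial σ ℂ) * e.2.map (C : ℂ → MvPolynomial σ ℂ) = 0 := by
    rw [← Matrix.map_mul, he, Matrix.map_zero _ C_0]
  refine ⟨⟨_, 1 - (X e.1 : MvPolynomial σ ℂ) • e.2.map (C : ℂ → MvPolynomial σ ℂ), ?_, ?_⟩, rfl⟩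
  · simp only [add_mul, mul_sub, one_mul, mul_one, Matrix.smul_mul, Matrix.mul_smul, hNN,
      smul_zero, add_zero, add_sub_cancel_right]
  · simp only [sub_mul, mul_add, one_mul, mul_one, Matrix.smul_mul, Matrix.mul_smul, hNN,
      smul_zero, sub_zero, sub_add_cancel]

/-- The chain of a list of square-zero letters is a unit. -/
private theorem ro_isUnit_prod {σ : Type}
    (F : σ × Matrix (Fin 3) (Fin 3) ℂ → Matrix (Fin 3) (Fin 3) (MvPolynomial σ ℂ))
    (hF : ∀ e, F e = 1 + (X e.1 : MvPolynomial σ ℂ) • e.2.map (C : ℂ → MvPolynomial σ ℂ))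
    (L : List (σ × Matrix (Fin 3) (Fin 3) ℂ)) (hL : ∀ e ∈ L, e.2 * e.2 = 0) :
    IsUnit (L.map F).prod := by
  induction L with
  | nil =>
    rw [List.map_nil, List.prod_nil]
    exact isUnit_one
  | cons e L ih =>
    rw [List.map_cons, List.prod_cons, hF]
    exact (ro_isUnit_factor e (hL e List.mem_cons_self)).mul
      (ih fun e' he' => hL e' (List.mem_cons_of_mem e he'))

/-- **One read: comparing coefficients.**  If `AB + x_i • M = E_02(P')` with the entries of `AB`
free of `x_i`, then for every exponent vector `m'` the matrix of `x^{m'}`-coefficients of `M` is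
`(coeff (m' + e_i) P') • E_02`. -/
private theorem ro_key {σ : Type} [DecidableEq σ] (i : σ)
    (AB M : Matrix (Fin 3) (Fin 3) (MvPolynomial σ ℂ)) (P' : MvPolynomial σ ℂ)
    (hAB : ∀ m : σ →₀ ℕ, m i ≠ 0 → ∀ k l, coeff m (AB k l) = 0)
    (h : AB + (X i : MvPolynomial σ ℂ) • M = Matrix.transvection 0 2 P')
    (m' : σ →₀ ℕ) (k l : Fin 3) :
    coeff m' (M k l) = Matrix.single (0 : Fin 3) 2 (coeff (m' + Finsupp.single i 1) P') k l := by
  have hmi : (m' + Finsupp.single i 1 : σ →₀ ℕ) i ≠ 0 := by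
    rw [Finsupp.add_apply, Finsupp.single_eq_same]
    exact Nat.add_one_ne_zero _
  have hm0 : (0 : σ →₀ ℕ) ≠ m' + Finsupp.single i 1 := fun h0 =>
    hmi (by rw [← h0, Finsupp.zero_apply])
  have hkl := congrArg (coeff (m' + Finsupp.single i 1)) (congrFun (congrFun h k) l)
  rw [Matrix.add_apply, coeff_add, hAB _ hmi, zero_add, Matrix.smul_apply, smul_eq_mul,
    coeff_X_mul', if_pos (Finsupp.mem_support_iff.mpr hmi), add_tsub_cancel_right,
    Matrix.transvection, Matrix.add_apply, coeff_add, Matrix.one_apply,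
    apply_ite (coeff (m' + Finsupp.single i 1)), coeff_one, if_neg hm0, coeff_zero, ite_self,
    zero_add] at hkl
  rw [hkl]
  by_cases hkl' : (0 : Fin 3) = k ∧ (2 : Fin 3) = l
  · obtain ⟨rfl, rfl⟩ := hkl'
    rw [Matrix.single_apply_same, Matrix.single_apply_same]
  · rw [Matrix.single_apply_of_ne (h := hkl'), Matrix.single_apply_of_ne (h := hkl'), coeff_zero]

/-- **Two-reads rigidity** (the one-read case).  If a chain of square-zero letters computes
`E_02(P')` and the variable `x_i` is read by at most one letter, then `x_i` occurs in `P'` only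
linearly with a constant coefficient: every monomial `m ≠ e_i` with `m i ≠ 0` has
`coeff m P' = 0`. -/
theorem chain_read_once : ∀ {σ : Type} [DecidableEq σ] (L : List (σ × Matrix (Fin 3) (Fin 3) ℂ))
    (P' : MvPolynomial σ ℂ),
    (∀ e ∈ L, e.2 * e.2 = 0) →
    (L.map (fun e => (1 : Matrix (Fin 3) (Fin 3) (MvPolynomial σ ℂ)) +
        (MvPolynomial.X e.1 : MvPolynomial σ ℂ) •
          e.2.map (MvPolynomial.C : ℂ → MvPolynomial σ ℂ))).prod =
      Matrix.transvection (0 : Fin 3) 2 P' →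
    ∀ i : σ, L.countP (fun e => decide (e.1 = i)) ≤ 1 →
    ∀ m : σ →₀ ℕ, m i ≠ 0 → m ≠ Finsupp.single i 1 → MvPolynomial.coeff m P' = 0 := by
  intro σ _ L P' hsq hL i hcount m hmi hm
  -- the factor of a letter
  let F : σ × Matrix (Fin 3) (Fin 3) ℂ → Matrix (Fin 3) (Fin 3) (MvPolynomial σ ℂ) :=
    fun e => 1 + (X e.1 : MvPolynomial σ ℂ) • e.2.map (C : ℂ → MvPolynomial σ ℂ)
  have hF : ∀ e, F e = 1 + (X e.1 : MvPolynomial σ ℂ) • e.2.map (C : ℂ → MvPolynomial σ ℂ) :=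
    fun _ => rfl
  have hL' : (L.map F).prod = Matrix.transvection 0 2 P' := hL
  clear hL
  by_cases h0 : ∀ e ∈ L, e.1 ≠ i
  · -- no letter reads `x_i`: `P'` is the `(0,2)` entry of an `x_i`-free matrix
    have hP' : (L.map F).prod 0 2 = P' := by
      rw [hL']
      simp [Matrix.transvection]
    rw [← hP']
    exact ro_free_prod F hF i L h0 m hmi 0 2
  -- exactly one letter `e₀` reads `x_i`: split `L` around it
  push Not at h0
  obtain ⟨e₀, he₀, hei⟩ := h0
  obtain ⟨L₁, L₂, rfl⟩ := List.append_of_mem he₀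
  subst hei
  have hc : (e₀ :: L₂).countP (fun e => decide (e.1 = e₀.1)) =
      L₂.countP (fun e => decide (e.1 = e₀.1)) + 1 :=
    List.countP_cons_of_pos (decide_eq_true rfl)
  rw [List.countP_append, hc] at hcount
  have hc₁ : L₁.countP (fun e => decide (e.1 = e₀.1)) = 0 := by omega
  have hc₂ : L₂.countP (fun e => decide (e.1 = e₀.1)) = 0 := by omega
  have h₁ : ∀ e ∈ L₁, e.1 ≠ e₀.1 := fun e he h =>
    List.countP_eq_zero.mp hc₁ e he (decide_eq_true h)
  have h₂ : ∀ e ∈ L₂, e.1 ≠ e₀.1 := fun e he h =>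
    List.countP_eq_zero.mp hc₂ e he (decide_eq_true h)
  -- the hypothesis reads `A * B + x_i • (A * (N * B)) = E_02(P')`
  rw [List.map_append, List.map_cons, List.prod_append, List.prod_cons, hF e₀, add_mul, one_mul,
    Matrix.smul_mul, mul_add, Matrix.mul_smul] at hL'
  have hAB : ∀ m : σ →₀ ℕ, m e₀.1 ≠ 0 →
      ∀ k l, coeff m (((L₁.map F).prod * (L₂.map F).prod) k l) = 0 := by
    intro m hm k l
    rw [← List.prod_append, ← List.map_append]
    exact ro_free_prod F hF e₀.1 (L₁ ++ L₂)
      (fun e he => (List.mem_append.mp he).elim (h₁ e) (h₂ e)) m hm k l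
  set M := (L₁.map F).prod * (e₀.2.map (C : ℂ → MvPolynomial σ ℂ) * (L₂.map F).prod) with hM
  have key := ro_key e₀.1 _ _ P' hAB hL'
  -- `M` is concentrated in its `(0,2)` entry `q`, and `coeff m' q = coeff (m' + e_i) P'`
  have hMq : M = Matrix.single 0 2 (M 0 2) := by
    refine Matrix.ext fun k l => ?_
    by_cases hkl : (0 : Fin 3) = k ∧ (2 : Fin 3) = l
    · obtain ⟨rfl, rfl⟩ := hkl
      rw [Matrix.single_apply_same]
    · rw [Matrix.single_apply_of_ne (h := hkl)]
      refine MvPolynomial.ext _ _ fun m' => ?_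
      rw [key, Matrix.single_apply_of_ne (h := hkl), coeff_zero]
  have hq : ∀ m' : σ →₀ ℕ, coeff m' (M 0 2) = coeff (m' + Finsupp.single e₀.1 1) P' :=
    fun m' => by rw [key, Matrix.single_apply_same]
  -- `q` is a constant: `N = A⁻¹ * (q • E_02) * B⁻¹ = q • R` with `N ≠ 0` constant
  obtain ⟨c, hc⟩ : ∃ c : ℂ, M 0 2 = C c := by
    by_cases hN0 : e₀.2 = 0
    · refine ⟨0, ?_⟩
      rw [hM, hN0, Matrix.map_zero _ C_0, zero_mul, mul_zero, Matrix.zero_apply, C_0]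
    obtain ⟨k, l, hkl⟩ : ∃ k l, e₀.2 k l ≠ 0 := by
      by_contra! h
      exact hN0 (Matrix.ext h)
    obtain ⟨u, hu⟩ := ro_isUnit_prod F hF L₁ fun e he => hsq e (List.mem_append_left _ he)
    obtain ⟨v, hv⟩ := ro_isUnit_prod F hF L₂ fun e he =>
      hsq e (List.mem_append_right _ (List.mem_cons_of_mem _ he))
    have hNq : e₀.2.map (C : ℂ → MvPolynomial σ ℂ) =
        M 0 2 • ((u⁻¹).val * Matrix.single (0 : Fin 3) (2 : Fin 3) (1 : MvPolynomial σ ℂ) *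
          (v⁻¹).val) := by
      rw [← Matrix.smul_mul, ← Matrix.mul_smul, Matrix.smul_single, smul_eq_mul, mul_one, ← hMq,
        hM, ← hu, ← hv, Units.inv_mul_cancel_left, Units.mul_inv_cancel_right]
    have hdvd : M 0 2 ∣ C (e₀.2 k l) := by
      have hkl' := congrFun (congrFun hNq k) l
      rw [Matrix.map_apply, Matrix.smul_apply, smul_eq_mul] at hkl'
      exact ⟨_, hkl'⟩
    obtain ⟨c, -, hc⟩ := MvPolynomial.isUnit_iff_eq_C_of_isReduced.mp
      (isUnit_of_dvd_unit hdvd ((isUnit_iff_ne_zero.mpr hkl).map C))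
    exact ⟨c, hc⟩
  -- conclusion: `m = m' + e_i` with `m' ≠ 0`, so `coeff m P' = coeff m' q = coeff m' (C c) = 0`
  have hle : Finsupp.single e₀.1 1 ≤ m :=
    Finsupp.single_le_iff.mpr (Nat.one_le_iff_ne_zero.mpr hmi)
  have hm' : m - Finsupp.single e₀.1 1 ≠ 0 := fun h =>
    hm (by rw [← tsub_add_cancel_of_le hle, h, zero_add])
  rw [← tsub_add_cancel_of_le hle, ← hq, hc, coeff_C, if_neg (Ne.symm hm')]

end Summit.ValiantsHypothesis.ValiantsHypothesis.Theorems.WordPerSuperQuartic
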